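import Mathlib
import Summits.Ventures.PercRepro2.Defs
import Summits.Ventures.PercRepro2.Independence
import Summits.Ventures.PercRepro2.Harris
import Summits.Ventures.PercRepro2.Graph
import Summits.Ventures.PercRepro2.Exploration
import Summits.Ventures.PercRepro2.Events
import Summits.Ventures.PercRepro2.FourFunctions
import Summits.Ventures.PercRepro2.Induced
import Summits.Ventures.PercRepro2.Frontier
import Summits.Ventures.PercRepro2.ObsIndependence
import Summits.Ventures.PercRepro2.BHK
import Summits.Ventures.PercRepro2.BHKEvents
import Summits.Ventures.PercRepro2.SideAgreement
import Summits.Ventures.PercRepro2.VdBKahn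
import Summits.Ventures.PercRepro2.BHKAvoid
import Summits.Ventures.PercRepro2.R2PrimeThreeReduction
import Summits.Ventures.PercRepro2.YBridge
import Summits.Ventures.PercRepro2.Yu1Functionals
import Summits.Ventures.PercRepro2.Yu1Events
import Summits.Ventures.PercRepro2.Yu1
import Summits.Ventures.PercRepro2.LBSplit
import Summits.Ventures.PercRepro2.YDelta
import Summits.Ventures.PercRepro2.SD
import Summits.Ventures.PercRepro2.Threshold
import Summits.Ventures.PercRepro2.Lambda
import Summits.Ventures.PercRepro2.LambdaTau
import Summits.Ventures.PercRepro2.LambdaSlack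
import Summits.Ventures.PercRepro2.HF2
import Summits.Ventures.PercRepro2.Yu2
import Summits.Ventures.PercRepro2.N0
import Summits.Ventures.PercRepro2.Y
import Summits.Ventures.PercRepro2.YDeltaTools
import Summits.Ventures.PercRepro2.ZDelta
import Summits.Ventures.PercRepro2.ZExpand
import Summits.Ventures.PercRepro2.ISplit
import Summits.Ventures.PercRepro2.MRl
import Summits.Ventures.PercRepro2.ZOloc
import Summits.Ventures.PercRepro2.SideBridge
import Summits.Ventures.PercRepro2.HCov
import Summits.Ventures.PercRepro2.BasePrime
import Summits.Ventures.PercRepro2.PendantRoot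

/-!
# (HCOV) is symmetric in the two roots (blind cell PercRepro2, typer-1; HCov.lean docstring:
"row 2′HCOV: labelling-free, `l ↔ h` symmetric")

`Gc p ends o a₂ a₁ a₃ b = Gc p ends o a₁ a₂ a₃ b` (`Gc_swap`): the events `Q` and `PD` are symmetric,
`T` and `T′` exchange, every `σ`-moment with an odd number of `σ`'s changes sign together with `gap`,
so the cleared form is invariant. Hence `HCov_swap`, and the pendant-at-root theorem
(`PendantRoot.HCov_pendant_root`, `a₃` a leaf at `a₂`) transfers to a leaf at `a₁`
(`HCov_pendant_root'`): (HCOV) holds whenever `a₃` is a leaf attached to EITHER root.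
-/

namespace Summit.Ventures.PercRepro2

open UnionCluster CovForm

namespace CovForm

variable {V : Type*} {E : Type*} [Fintype E] [DecidableEq E] {R : Type*} [Field R]
  [LinearOrder R] [IsStrictOrderedRing R]

omit [Fintype E] [DecidableEq E] in
/-- `Q` is symmetric in the roots. -/
lemma avoidAll_root_swap (ends : E → Sym2 V) (a₁ a₂ : V) :
    avoidAll ends a₁ {a₂} = avoidAll ends a₂ {a₁} := by
  ext ω
  simp only [avoidAll, Set.mem_setOf_eq, Finset.mem_singleton, forall_eq]
  exact ⟨fun h hc => h (conn_symm hc), fun h hc => h (conn_symm hc)⟩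

omit [Fintype E] [DecidableEq E] in
/-- `PD` is symmetric in the roots. -/
lemma PDEvent_root_swap (ends : E → Sym2 V) (a₁ a₂ a₃ : V) :
    PDEvent ends a₂ a₁ a₃ = PDEvent ends a₁ a₂ a₃ := by
  unfold PDEvent Dtilde inU
  ext ω
  simp only [Set.mem_inter_iff, Set.mem_compl_iff, Set.mem_union, connEvent, Set.mem_setOf_eq]
  constructor
  · rintro ⟨h, h'⟩
    exact ⟨fun hc => h (conn_symm hc), fun hc => h' (Or.comm.1 hc)⟩
  · rintro ⟨h, h'⟩
    exact ⟨fun hc => h (conn_symm hc), fun hc => h' (Or.comm.1 hc)⟩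

omit [LinearOrder R] [IsStrictOrderedRing R] in
/-- **`Gc` is symmetric in the two roots.** -/
theorem Gc_swap (p : E → R) (ends : E → Sym2 V) (o a₁ a₂ a₃ b : V) :
    Gc p ends o a₂ a₁ a₃ b = Gc p ends o a₁ a₂ a₃ b := by
  unfold Gc DEF EQbo EQb3 EQb3o EQo EQ3 EQ3o PDb PDbo Do gap
  rw [avoidAll_root_swap, PDEvent_root_swap]
  ring

omit [IsStrictOrderedRing R] in
/-- **(HCOV) is symmetric in the two roots.** -/
theorem HCov_swap (p : E → R) (ends : E → Sym2 V) (o a₁ a₂ a₃ b : V) :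
    HCov p ends o a₂ a₁ a₃ b ↔ HCov p ends o a₁ a₂ a₃ b := by
  unfold HCov
  rw [Gc_swap]

end CovForm

namespace PendantRoot

variable {V : Type*} {E : Type*} [Fintype E] [DecidableEq E] [Fintype V] [DecidableEq V]
  {R : Type*} [Field R] [LinearOrder R] [IsStrictOrderedRing R]

/-- **(HCOV) at a pendant `a₃` attached to the root `a₁`** (by the root symmetry). -/
theorem HCov_pendant_root' (p : E → R) (hp : IsProbVec p) (ends : E → Sym2 V) {f : E} {a₃ a₁ : V}
    (hf : ends f = s(a₃, a₁)) (hleaf : ∀ e, a₃ ∈ ends e → e = f) (h31 : a₃ ≠ a₁) {o a₂ b : V}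
    (h32 : a₃ ≠ a₂) (ho : o ≠ a₃) (hb : b ≠ a₃) : HCov p ends o a₁ a₂ a₃ b :=
  (HCov_swap p ends o a₁ a₂ a₃ b).1 (HCov_pendant_root p ends hp hf hleaf h31 h32 ho hb)

/-- **(HCOV) whenever `a₃` is a leaf attached to either root.** -/
theorem HCov_pendant_either_root (p : E → R) (hp : IsProbVec p) (ends : E → Sym2 V) {f : E}
    {a₃ : V} (hleaf : ∀ e, a₃ ∈ ends e → e = f) {o a₁ a₂ b : V}
    (hf : ends f = s(a₃, a₂) ∨ ends f = s(a₃, a₁)) (h31 : a₃ ≠ a₁) (h32 : a₃ ≠ a₂)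
    (ho : o ≠ a₃) (hb : b ≠ a₃) : HCov p ends o a₁ a₂ a₃ b := by
  rcases hf with hf | hf
  · exact HCov_pendant_root p ends hp hf hleaf h32 h31 ho hb
  · exact HCov_pendant_root' p hp ends hf hleaf h31 h32 ho hb

end PendantRoot

end Summit.Ventures.PercRepro2
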